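import Summits.BirchSwinnertonDyer.BirchSwinnertonDyer.Theorems.ManinLocalTwoThreeShimuraQuotientConjugation
import Summits.BirchSwinnertonDyer.BirchSwinnertonDyer.Theorems.ManinLocalTwoThreeManinOfStevensConjectures
import Summits.BirchSwinnertonDyer.BirchSwinnertonDyer.Theorems.ManinLocalTwoThreeShimuraRationalThreeIsogeny
import Summits.BirchSwinnertonDyer.BirchSwinnertonDyer.Theorems.ManinLocalTwoThreeShimuraRationalTwoTorsionAnyModel
import Summits.BirchSwinnertonDyer.BirchSwinnertonDyer.Theorems.ManinLocalTwoThreeShimuraDefectLawAtThree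
import HarnessLib

/-!
# The index-`9` exclusion at every level: consequences for C3 (and the non-rectangular half at `2`)

Summit `BirchSwinnertonDyer`, route `ManinLocalTwoThree` (cell bsd-f2-manin), cruxes C3 `ManinPrimeToThreeAtNine` (stmt-BirchSwinnertonDyer-22968)
and C2 `ManinOddAtFour` (stmt-BirchSwinnertonDyer-22967); lead p1 gen 14.  Corollaries BY NAME of
`…ShimuraQuotientConjugation.not_periodLatticeGamma1_eq_three_mul_periodLattice` (**`Λ₁(f) ≠ 3Λ₀(f)` for every lattice-optimal
`X₀(N)`-datum, every `N`**) and of its `p = 2` half (index `4` forces a rectangular Néron lattice):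

* §1 `periodLatticeGamma1_eq_or_exists_Ψ₃_root_of_nine_dvd` — **DICHOTOMY at every level `9 ∣ N`** (was: `N = 9q` only,
  `periodLatticeGamma1_eq_or_exists_Ψ₃_root_of_nine_mul_prime`): for the optimal pair of a class, `Λ₁(f) = Λ₀(f)` and `|c₀| = |c₁|`, or `W₀`
  admits a rational `3`-isogeny (`W₀.Ψ₃` has a rational root); so without rational `3`-isogeny `ℓ ∣ c₀ ⟺ ℓ ∣ c₁` for every `ℓ`;
* §2 `natAbs_maninConstant₀_eq_three_mul_iff_not_ascends` — the Γ₀/Γ₁ DEFECT LAW at `3` (`…ShimuraDefectLawAtThree`) loses its index-`9`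
  branch: `|c₀| = 3|c₁| ⟺ (Λ₁ ≠ Λ₀ ∧ no kernel generator ascends)`;
* §3 `natAbs_maninConstant₀_eq_of_maxCovolume_of_nine_dvd` — **Stevens II (maximal covolume of the Stevens curve) ⟹ `|c₀| = |c₁|` at every
  `9 ∣ N`**; `not_three_dvd_maninConstant_of_stevensConjectures_of_nine_dvd`; and
  **`maninPrimeToThreeAtNine_of_stevens` : C3 ⟸ F-need ∧ Stevens I ∧ Stevens II** — the hypothesis `hne9` of
  `maninPrimeToThreeAtNine_of_stevensConjectures` is discharged; NO cell law remains on this road to C3;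
* §4 (`p = 2`, non-rectangular half) `periodLatticeGamma1_eq_or_exists_Ψ₂Sq_root_of_re_notMem` / `natAbs_maninConstant₀_eq_of_maxCovolume_of_re_notMem`:
  for an optimal curve whose Néron lattice is NOT rectangular (some `re z ∉ Λ_{E₀}`; e.g. `Δ < 0`), at `4 ∣ N`: `Λ₁ = Λ₀ ∧ |c₀| = |c₁|` or
  `W₀.Ψ₂Sq` has a rational root; and Stevens II ⟹ `|c₀| = |c₁|`.

HONEST FRAMING: §1–§2 and the lattice statements are unconditional; §3's C3 corollary is CONDITIONAL on F-need (statement-only) and Stevens'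
Conjectures I–II (OPEN; tree predicates, nothing asserted).  Manin's conjecture, C2, C3 and BSD are NOT proved.  No definitions, no named
facts, no sorry. [cite: Stevens1989, Conjectures I–III, Thm. 2.3, §2] [cite: Manin1972, §1.6]
-/

set_option autoImplicit false
-- the summit-side namespace `Summit.BirchSwinnertonDyer.BirchSwinnertonDyer.…` is the tree's (summit = sub-problem)
set_option linter.dupNamespace false

noncomputable section

open scoped Classical
open WeierstrassCurve Literature.NumberTheory.EllipticCurves Literature.NumberTheory.EllipticCurves.ModularForms
open CongruenceSubgroup Polynomial
open Summit.BirchSwinnertonDyer.Rank1Residual.ManinAdditive.ShimuraKernel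
open Summit.BirchSwinnertonDyer.Rank1Residual.ManinAdditive.KatoCurve
open Summit.BirchSwinnertonDyer.Rank1Residual.ManinConstant

namespace Summit.BirchSwinnertonDyer.BirchSwinnertonDyer.Theorems.ManinLocalTwoThree

variable {W₁ W₀ : WeierstrassCurve ℚ} [W₁.IsElliptic] [W₁.IsGloballyMinimal] [W₀.IsElliptic]
  [W₀.IsGloballyMinimal] {N : ℕ} [NeZero N]

/-! ## §1 The dichotomy at every level `9 ∣ N` -/

/-- **DICHOTOMY at `9 ∣ N` (every level)**: for the optimal pair of a class, `Λ₁(f) = Λ₀(f)` and `|c₀| = |c₁|`, or `W₀` admits a rational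
`3`-isogeny (`W₀.Ψ₃` has a rational root).  The middle branch `Λ₁ = 3Λ₀` of `trichotomy_shimura_of_nine_dvd_level` is void
(`not_periodLatticeGamma1_eq_three_mul_periodLattice`).  Unconditional. [cite: Stevens1989, §2] -/
theorem periodLatticeGamma1_eq_or_exists_Ψ₃_root_of_nine_dvd (D₁ : Gamma1ParametrizationData W₁ N)
    (D₀ : ModularParametrizationData W₀ N) (hiso : IsIsogenous W₁ W₀) (h₁ : D₁.IsOptimal)
    (h₀ : ∀ z ∈ D₀.L.lattice, ∃ w ∈ periodLattice D₀.f, z = D₀.c * w) (h9 : 3 ^ 2 ∣ N) :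
    (periodLatticeGamma1 D₀.f = periodLattice D₀.f ∧ D₀.maninConstant.natAbs = D₁.maninConstant.natAbs) ∨
      ∃ x : ℚ, W₀.Ψ₃.eval x = 0 := by
  have hf : D₁.f = D₀.f := D₁.f_eq_of_isIsogenous D₀ hiso
  rcases trichotomy_shimura_of_nine_dvd_level D₁ D₀ hiso h₁ h₀ h9 with h | h | hx
  · exact Or.inl ⟨h, natAbs_maninConstant₀_eq_of_periodLatticeGamma1_eq_periodLattice D₁ D₀ h₁ h₀ hf h⟩
  · exact absurd h (not_periodLatticeGamma1_eq_three_mul_periodLattice D₀ h₀)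
  · exact Or.inr hx

/-- **At `9 ∣ N` (every level): an optimal curve WITHOUT rational `3`-isogeny is Stevens-aligned** — `Λ₁(f) = Λ₀(f)` and `|c₀| = |c₁|`.
Unconditional. [cite: Stevens1989, §2] -/
theorem stevens_eq_optimal_of_noRationalThreeIsogeny_of_nine_dvd (D₁ : Gamma1ParametrizationData W₁ N)
    (D₀ : ModularParametrizationData W₀ N) (hiso : IsIsogenous W₁ W₀) (h₁ : D₁.IsOptimal)
    (h₀ : ∀ z ∈ D₀.L.lattice, ∃ w ∈ periodLattice D₀.f, z = D₀.c * w) (h9 : 3 ^ 2 ∣ N)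
    (hno : ∀ x : ℚ, W₀.Ψ₃.eval x ≠ 0) :
    periodLatticeGamma1 D₀.f = periodLattice D₀.f ∧ D₀.maninConstant.natAbs = D₁.maninConstant.natAbs := by
  rcases periodLatticeGamma1_eq_or_exists_Ψ₃_root_of_nine_dvd D₁ D₀ hiso h₁ h₀ h9 with h | ⟨x, hx⟩
  · exact h
  · exact absurd hx (hno x)

/-- **At `9 ∣ N` (every level), without rational `3`-isogeny: `ℓ ∣ c₀ ⟺ ℓ ∣ c₁`** for every integer `ℓ` (in particular C3 for `D₀` ⟺ C3
for the Stevens datum). Unconditional. [cite: Stevens1989, §2] -/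
theorem dvd_maninConstant₀_iff_of_noRationalThreeIsogeny_of_nine_dvd (D₁ : Gamma1ParametrizationData W₁ N)
    (D₀ : ModularParametrizationData W₀ N) (hiso : IsIsogenous W₁ W₀) (h₁ : D₁.IsOptimal)
    (h₀ : ∀ z ∈ D₀.L.lattice, ∃ w ∈ periodLattice D₀.f, z = D₀.c * w) (h9 : 3 ^ 2 ∣ N)
    (hno : ∀ x : ℚ, W₀.Ψ₃.eval x ≠ 0) (ℓ : ℤ) :
    ℓ ∣ D₀.maninConstant ↔ ℓ ∣ D₁.maninConstant := by
  have heq := (stevens_eq_optimal_of_noRationalThreeIsogeny_of_nine_dvd D₁ D₀ hiso h₁ h₀ h9 hno).2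
  rw [← Int.natAbs_dvd_natAbs, ← Int.natAbs_dvd_natAbs (b := D₁.maninConstant), heq]

/-! ## §2 The defect law at `3` without the index branch -/

/-- **DEFECT LAW at `3`, index branch removed**: at `9 ∣ N`, `|c₀| = 3|c₁|` iff `Λ₁(f) ≠ Λ₀(f)` and NO kernel generator
`w ∈ Λ₁ ∖ 3Λ₀` ascends (no rational `q = ℘(c₀w/3)` with the Vélu congruences).  (`natAbs_maninConstant₀_eq_three_mul_iff_index_nine_or_not_ascends`
with its first disjunct void.)  Unconditional. [cite: Stevens1989, §2] [cite: Velu1971] -/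
theorem natAbs_maninConstant₀_eq_three_mul_iff_not_ascends (D₁ : Gamma1ParametrizationData W₁ N)
    (D₀ : ModularParametrizationData W₀ N) (hiso : IsIsogenous W₁ W₀) (h₁ : D₁.IsOptimal)
    (h₀ : ∀ z ∈ D₀.L.lattice, ∃ w ∈ periodLattice D₀.f, z = D₀.c * w) (h9 : 3 ^ 2 ∣ N) :
    D₀.maninConstant.natAbs = 3 * D₁.maninConstant.natAbs ↔
      (periodLatticeGamma1 D₀.f ≠ periodLattice D₀.f ∧
        ∀ w ∈ periodLatticeGamma1 D₀.f, (∀ v ∈ periodLattice D₀.f, w ≠ 3 * v) →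
          ¬ ∃ q : ℚ, (q : ℂ) = D₀.L.weierstrassP ((D₀.c : ℂ) * w / 3) ∧
            81 * W₁.c₄ = 1440 * q ^ 2 - 9 * W₀.c₄ ∧
            729 * W₁.c₆ = 60480 * q ^ 3 - 756 * W₀.c₄ * q - 27 * W₀.c₆) := by
  rw [natAbs_maninConstant₀_eq_three_mul_iff_index_nine_or_not_ascends D₁ D₀ hiso h₁ h₀ h9]
  exact ⟨fun h ↦ h.resolve_left (not_periodLatticeGamma1_eq_three_mul_periodLattice D₀ h₀), Or.inr⟩

/-! ## §3 Stevens' conjectures and C3 -/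

/-- **At `9 ∣ N` (every level): Stevens II for the Stevens curve ⟹ `|c₀| = |c₁|`.**  Tripling would force `Λ₁ = 3Λ₀`
(`index_nine_of_maxCovolume_of_natAbs_eq_three_mul`), which never occurs.  CONDITIONAL on Stevens II (hypothesis `hmax`).
[cite: Stevens1989, Conjecture II, Thm. 2.3] -/
theorem natAbs_maninConstant₀_eq_of_maxCovolume_of_nine_dvd (D₁ : Gamma1ParametrizationData W₁ N)
    (D₀ : ModularParametrizationData W₀ N) (hiso : IsIsogenous W₁ W₀) (h₁ : D₁.IsOptimal)
    (h₀ : ∀ z ∈ D₀.L.lattice, ∃ w ∈ periodLattice D₀.f, z = D₀.c * w) (h9 : 3 ^ 2 ∣ N)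
    (hmax : IsMaxCovolumeInClass W₁) : D₀.maninConstant.natAbs = D₁.maninConstant.natAbs := by
  rcases natAbs_maninConstant₀_eq_or_eq_three_mul_of_nine_dvd_level D₁ D₀ hiso h₁ h₀ h9 with h | h
  · exact h
  · exact absurd (index_nine_of_maxCovolume_of_natAbs_eq_three_mul D₁ D₀ hiso h₀ h9 hmax h)
      (not_periodLatticeGamma1_eq_three_mul_periodLattice D₀ h₀)

/-- **At `9 ∣ N` (every level): Stevens I ∧ Stevens II ⟹ `3 ∤ c₀`** (indeed `|c₀| = |c₁| = 1`).  CONDITIONAL (both conjectures OPEN).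
[cite: Stevens1989, Conjectures I–II] -/
theorem not_three_dvd_maninConstant_of_stevensConjectures_of_nine_dvd (D₁ : Gamma1ParametrizationData W₁ N)
    (D₀ : ModularParametrizationData W₀ N) (hiso : IsIsogenous W₁ W₀) (h₁ : D₁.IsOptimal)
    (h₀ : ∀ z ∈ D₀.L.lattice, ∃ w ∈ periodLattice D₀.f, z = D₀.c * w) (h9 : 3 ^ 2 ∣ N)
    (hSt1 : StevensConstantOne) (hmax : IsMaxCovolumeInClass W₁) : ¬ (3 : ℤ) ∣ D₀.maninConstant :=
  not_three_dvd_maninConstant_of_stevensConjectures D₁ D₀ hiso h₁ h₀ h9 hSt1 hmax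
    (not_periodLatticeGamma1_eq_three_mul_periodLattice D₀ h₀)

omit [W₁.IsElliptic] [W₁.IsGloballyMinimal] [W₀.IsElliptic] [W₀.IsGloballyMinimal] [NeZero N] in
/-- **C3 `ManinPrimeToThreeAtNine` ⟸ F-need ∧ Stevens I ∧ Stevens II** — the index-`9` hypothesis of
`maninPrimeToThreeAtNine_of_stevensConjectures` is now a theorem, so Manin's conjecture at `3` (for lattice-optimal `X₀(N)`-data, `9 ∣ N`)
follows from the existence of the Stevens datum and Stevens' two 1989 conjectures ALONE.  CONDITIONAL: F-need is statement-only, Stevens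
I/II are OPEN; C3 OPEN; BSD is not proved by this. [cite: Stevens1989, Conjectures I–III, Thm. 2.3] -/
theorem maninPrimeToThreeAtNine_of_stevens (hex : exists_optimal_gamma1ParametrizationData) (hSt1 : StevensConstantOne)
    (hSt2 : ∀ (W₁ : WeierstrassCurve ℚ) [W₁.IsElliptic] [W₁.IsGloballyMinimal] {N : ℕ} [NeZero N]
      (D₁ : Gamma1ParametrizationData W₁ N), D₁.IsOptimal → 3 ^ 2 ∣ N → IsMaxCovolumeInClass W₁) :
    Summit.BirchSwinnertonDyer.BirchSwinnertonDyer.Theses.ManinLocalTwoThree.ManinPrimeToThreeAtNine :=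
  maninPrimeToThreeAtNine_of_stevensConjectures hex hSt1 hSt2
    fun _ _ _ _ _ D₀ h₀ _ ↦ not_periodLatticeGamma1_eq_three_mul_periodLattice D₀ h₀

/-! ## §4 `p = 2`: the non-rectangular half -/

/-- **At `4 ∣ N`, for an optimal curve whose Néron lattice is NOT rectangular** (some `z ∈ Λ_{E₀}` with `re z ∉ Λ_{E₀}`): `Λ₁(f) = Λ₀(f)` and
`|c₀| = |c₁|`, or `W₀.Ψ₂Sq` has a rational root (a rational `2`-torsion abscissa).  The index-`4` branch of
`trichotomy_shimura_of_four_dvd_level_anyModel` is void for such lattices (`not_periodLatticeGamma1_eq_two_mul_of_re_notMem`).  Unconditional.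
[cite: Stevens1989, §2] -/
theorem periodLatticeGamma1_eq_or_exists_Ψ₂Sq_root_of_re_notMem (D₁ : Gamma1ParametrizationData W₁ N)
    (D₀ : ModularParametrizationData W₀ N) (hiso : IsIsogenous W₁ W₀) (h₁ : D₁.IsOptimal)
    (h₀ : ∀ z ∈ D₀.L.lattice, ∃ w ∈ periodLattice D₀.f, z = D₀.c * w) (h4 : 2 ^ 2 ∣ N)
    {z : ℂ} (hz : z ∈ D₀.L.lattice) (hre : (z.re : ℂ) ∉ D₀.L.lattice) :
    (periodLatticeGamma1 D₀.f = periodLattice D₀.f ∧ D₀.maninConstant.natAbs = D₁.maninConstant.natAbs) ∨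
      ∃ x : ℚ, W₀.Ψ₂Sq.eval x = 0 := by
  have hf : D₁.f = D₀.f := D₁.f_eq_of_isIsogenous D₀ hiso
  rcases trichotomy_shimura_of_four_dvd_level_anyModel D₁ D₀ hiso h₁ h₀ h4 with h | h | hx
  · exact Or.inl ⟨h, natAbs_maninConstant₀_eq_of_periodLatticeGamma1_eq_periodLattice D₁ D₀ h₁ h₀ hf h⟩
  · exact absurd h (not_periodLatticeGamma1_eq_two_mul_of_re_notMem D₀ h₀ hz hre)
  · exact Or.inr hx

/-- **At `4 ∣ N`, non-rectangular Néron lattice: Stevens II for the Stevens curve ⟹ `|c₀| = |c₁|`** (doubling would force `Λ₁ = 2Λ₀`,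
`index_four_of_maxCovolume_of_natAbs_eq_two_mul`, impossible here).  CONDITIONAL on Stevens II; the rectangular case stays OPEN.
[cite: Stevens1989, Conjecture II, Thm. 2.3] -/
theorem natAbs_maninConstant₀_eq_of_maxCovolume_of_re_notMem (D₁ : Gamma1ParametrizationData W₁ N)
    (D₀ : ModularParametrizationData W₀ N) (hiso : IsIsogenous W₁ W₀) (h₁ : D₁.IsOptimal)
    (h₀ : ∀ z ∈ D₀.L.lattice, ∃ w ∈ periodLattice D₀.f, z = D₀.c * w) (h4 : 2 ^ 2 ∣ N)
    (hmax : IsMaxCovolumeInClass W₁) {z : ℂ} (hz : z ∈ D₀.L.lattice) (hre : (z.re : ℂ) ∉ D₀.L.lattice) :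
    D₀.maninConstant.natAbs = D₁.maninConstant.natAbs :=
  natAbs_maninConstant₀_eq_of_maxCovolume_of_index_ne_four D₁ D₀ hiso h₁ h₀ h4 hmax
    (not_periodLatticeGamma1_eq_two_mul_of_re_notMem D₀ h₀ hz hre)

end Summit.BirchSwinnertonDyer.BirchSwinnertonDyer.Theorems.ManinLocalTwoThree

end
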